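import Summits.CriticalPhenomena.CardyFormulaZ2.Theses.CardyRotToConf
import Literature.Probability.RandomPlanarGeometry.SLEImageDriverMeasurable
import HarnessLib

/-!
# Stub `stub_sleImageDriverMeasurable` of line `germ-label-transport` (crux `stmt-CriticalPhenomena-0698`)

Brick (b4) of `stub_isLocal` (LSW locality of SLE₆, restriction form; the image driving function
`W̃_t = W_t + L_A − L_{B_t}` of Lawler–Schramm–Werner (2003) §5): the image driving path
functional `imageDrvFnK κ A t = W_t − L_{B_t} 𝟙{alive}` (`SLEImageDriverFunctional.lean`) is a
measurable functional of the driving path. The registered stub signature, an instance of the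
Literature theorem `measurable_imageDrvFnK` (`SLEImageDriverMeasurable.lean`:
`ω ↦ L_{B_t(ω)} 𝟙{alive}` is the pointwise limit of `L` of the dyadic outer hulls of measurable
finite configurations, `tendsto_starShift_outerHull`).
-/

noncomputable section

open scoped NNReal
open Literature.Probability.RandomPlanarGeometry

namespace Summit.CriticalPhenomena.CardyFormulaZ2.Theorems.CardyRotToConfR2SymmetryUpgrade

/-- **(b4).** The image driving functional `imageDrvFnK κ A t` of a nonempty `*`-hull `A` is
measurable on path space `C(ℝ≥0, ℝ)` (Borel σ-algebra).
[cite: LawlerSchrammWerner2003Restriction, §5] -/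
theorem stub_sleImageDriverMeasurable : ∀ [MeasurableSpace C(NNReal, ℝ)] [BorelSpace C(NNReal, ℝ)]
    (κ : NNReal) {A : Set ℂ}, IsStarHull A → A.Nonempty → ∀ t : NNReal,
      Measurable (imageDrvFnK κ A t) := by
  intro _ _ κ A hA hne t
  exact measurable_imageDrvFnK κ hA hne t

end Summit.CriticalPhenomena.CardyFormulaZ2.Theorems.CardyRotToConfR2SymmetryUpgrade

end
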